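import Summits.AtomisticToContinuum.FouriersLaw.Theorems.OddSectorIrreversibilityTapLeakBoundBlockConeEnergy
import Summits.AtomisticToContinuum.FouriersLaw.Theorems.OddSectorIrreversibilityTapLeakBoundKickCone

/-!
# `TapLeakBound` (stmt-AtomisticToContinuum-15159), line `SketchIdeator2`: block light cone — the maximal inequality

Helper file (`--supports stmt-AtomisticToContinuum-15159`) for crux
P = `Summit.AtomisticToContinuum.FouriersLaw.Theses.OddSectorIrreversibility.TapLeakBound`, registered stub `stub_kickCone`
(C′ `ResampledKickCone`). The deterministic block light cone (`…BlockCone*.lean`) is conditioned on an energy/position box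
along the closed flow during `[0, τ]`; by `…BlockConeEnergy.lean` the site energy along the flow is bounded by the ENERGY
BUDGET `B(x) = h(x) + ∫_{(0,τ]} (|f| + |g|)(Φ_t x) dt` (`f, g` the two adjacent bond currents). This file proves the
probabilistic half at the second-moment level, UNIFORMLY IN `N` (only Liouville invariance of `μ_T`, Tonelli, Markov and
Chebyshev are used — no mixing, no gap):

* `budget_measurable`, `sq_budgetIntegral_le`, `integrable_sq_budgetIntegral` — measurability of the time-integrated
  transported observable, the Cauchy–Schwarz-in-time bound `(∫_{(0,τ]}(|f|+|g|)∘Φ)² ≤ 2τ∫_{(0,τ]}(f²+g²)∘Φ`, integrability;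
* `measureReal_budget_gt_le` (registered sub-goal `stub_blockMaximal`) — **the maximal inequality**: for `h ≥ 0`
  integrable, `f, g` continuous in `L²(μ_T)`, `τ ≥ 0`, `E > 0`,
  `μ_T{x : E < h(x) + ∫_{(0,τ]}(|f(Φ_t x)| + |g(Φ_t x)|)dt} ≤ (2/E)∫h dμ_T + (8τ²/E²)(∫f² dμ_T + ∫g² dμ_T)`
  (Markov on `h`, Chebyshev on the time integral, `∫∫_{(0,τ]} f(Φ_t x)² dt dμ_T = τ∫f² dμ_T` by invariance —
  `CoboundaryCeiling.integral_setIntegral_sq_comp_detFlow`).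

With `h = h_m` (site energy, `∫h_m dμ_T ≤ C_h Z`) and `f, g = j_{m-1}, j_m` (`∫j² dμ_T ≤ C_j Z`, `integral_sq_bondCurrent_le`)
this is the `N`-uniform Gibbs price of the box event of the block cone (polynomial in `E`; higher moments give higher orders).
References: folklore. Nothing here closes the item.
-/

noncomputable section

open MeasureTheory Filter Topology Set Function Metric
open scoped NNReal ENNReal

namespace Summit.AtomisticToContinuum.FouriersLaw.Theorems.OddSectorIrreversibility.TapLeak

open Literature.MathematicalPhysics.KineticTheory.HeatConduction
open Literature.MathematicalPhysics.KineticTheory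
open Summit.AtomisticToContinuum.FouriersLaw.Theorems.ClosedConeSensitivity.Negative.ZeroFrictionDictionary
open Summit.AtomisticToContinuum.FouriersLaw.Theorems.OddSectorIrreversibility.Corrector
open Summit.AtomisticToContinuum.FouriersLaw.Theorems.OddSectorWitness
open Summit.AtomisticToContinuum.FouriersLaw.Theorems.SubBallisticWindow.CoboundaryCeiling

/-! ### §11 The time-integrated transported observable -/

section Budget

variable {ω₂ lam β : ℝ} (hω : 0 < ω₂) (hl : 0 ≤ lam) (hβ : 0 ≤ β) (γ : ℝ) (N : ℕ) {T : ℝ}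
include hω hl hβ

/-- The time-integrated transported observable `x ↦ ∫_{(0,τ]} (|f| + |g|)(Φ_t x) dt` is measurable (joint measurability
of the closed flow + Fubini). [folklore] -/
theorem budget_stronglyMeasurable {f g : PhaseSpace N → ℝ} (hf : Continuous f) (hg : Continuous g) (τ : ℝ) :
    StronglyMeasurable fun x : PhaseSpace N =>
      ∫ t in Ioc (0 : ℝ) τ, (|f (detFlow ω₂ lam β N t x)| + |g (detFlow ω₂ lam β N t x)|) := by
  have hG : Measurable fun p : ℝ × PhaseSpace N =>
      |f (detFlow ω₂ lam β N p.1 p.2)| + |g (detFlow ω₂ lam β N p.1 p.2)| :=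
    ((hf.measurable.comp (measurable_detFlow_uncurry hω hl hβ N)).abs).add
      ((hg.measurable.comp (measurable_detFlow_uncurry hω hl hβ N)).abs)
  have hFs : StronglyMeasurable fun p : PhaseSpace N × ℝ =>
      |f (detFlow ω₂ lam β N p.2 p.1)| + |g (detFlow ω₂ lam β N p.2 p.1)| :=
    (hG.comp measurable_swap).stronglyMeasurable
  have key := hFs.integral_prod_right' (ν := volume.restrict (Ioc (0 : ℝ) τ))
  exact key

/-- **Cauchy–Schwarz in time**: `(∫_{(0,τ]}(|f|+|g|)∘Φ_t x dt)² ≤ 2τ ∫_{(0,τ]}(f² + g²)∘Φ_t x dt` (`τ ≥ 0`). [folklore] -/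
theorem sq_budgetIntegral_le {f g : PhaseSpace N → ℝ} (hf : Continuous f) (hg : Continuous g) {τ : ℝ} (hτ : 0 ≤ τ)
    (x : PhaseSpace N) :
    (∫ t in Ioc (0 : ℝ) τ, (|f (detFlow ω₂ lam β N t x)| + |g (detFlow ω₂ lam β N t x)|)) ^ 2 ≤
      2 * τ * ((∫ t in Ioc (0 : ℝ) τ, (f (detFlow ω₂ lam β N t x)) ^ 2) +
        ∫ t in Ioc (0 : ℝ) τ, (g (detFlow ω₂ lam β N t x)) ^ 2) := by
  have hΦc : Continuous fun t => detFlow ω₂ lam β N t x := Corrector.continuous_detFlow_time hω hl hβ N x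
  have hfc : Continuous fun t => f (detFlow ω₂ lam β N t x) := hf.comp hΦc
  have hgc : Continuous fun t => g (detFlow ω₂ lam β N t x) := hg.comp hΦc
  have hFc : Continuous fun t => |f (detFlow ω₂ lam β N t x)| + |g (detFlow ω₂ lam β N t x)| := hfc.abs.add hgc.abs
  have hif : IntegrableOn (fun t => (f (detFlow ω₂ lam β N t x)) ^ 2) (Ioc (0 : ℝ) τ) := (hfc.pow 2).integrableOn_Ioc
  have hig : IntegrableOn (fun t => (g (detFlow ω₂ lam β N t x)) ^ 2) (Ioc (0 : ℝ) τ) := (hgc.pow 2).integrableOn_Ioc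
  have hiF : IntegrableOn (fun t => (|f (detFlow ω₂ lam β N t x)| + |g (detFlow ω₂ lam β N t x)|) ^ 2) (Ioc (0 : ℝ) τ) :=
    (hFc.pow 2).integrableOn_Ioc
  have hifg : IntegrableOn (fun t => 2 * ((f (detFlow ω₂ lam β N t x)) ^ 2 + (g (detFlow ω₂ lam β N t x)) ^ 2))
      (Ioc (0 : ℝ) τ) := (((hfc.pow 2).add (hgc.pow 2)).const_mul 2).integrableOn_Ioc
  have h1 := sq_setIntegral_Ioc_le hτ hFc
  have h2 : ∫ t in Ioc (0 : ℝ) τ, (|f (detFlow ω₂ lam β N t x)| + |g (detFlow ω₂ lam β N t x)|) ^ 2 ≤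
      ∫ t in Ioc (0 : ℝ) τ, 2 * ((f (detFlow ω₂ lam β N t x)) ^ 2 + (g (detFlow ω₂ lam β N t x)) ^ 2) := by
    refine setIntegral_mono_on hiF hifg measurableSet_Ioc fun t _ => ?_
    have hsq : ∀ a b : ℝ, (|a| + |b|) ^ 2 ≤ 2 * (a ^ 2 + b ^ 2) := fun a b => by
      rw [← sq_abs a, ← sq_abs b]; nlinarith [sq_nonneg (|a| - |b|)]
    exact hsq _ _
  have h3 : ∫ t in Ioc (0 : ℝ) τ, 2 * ((f (detFlow ω₂ lam β N t x)) ^ 2 + (g (detFlow ω₂ lam β N t x)) ^ 2) =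
      2 * ((∫ t in Ioc (0 : ℝ) τ, (f (detFlow ω₂ lam β N t x)) ^ 2) +
        ∫ t in Ioc (0 : ℝ) τ, (g (detFlow ω₂ lam β N t x)) ^ 2) := by
    rw [integral_const_mul, integral_add hif hig]
  calc _ ≤ τ * ∫ t in Ioc (0 : ℝ) τ, (|f (detFlow ω₂ lam β N t x)| + |g (detFlow ω₂ lam β N t x)|) ^ 2 := h1
    _ ≤ τ * ∫ t in Ioc (0 : ℝ) τ, 2 * ((f (detFlow ω₂ lam β N t x)) ^ 2 + (g (detFlow ω₂ lam β N t x)) ^ 2) :=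
        mul_le_mul_of_nonneg_left h2 hτ
    _ = _ := by rw [h3]; ring

/-- **THE MAXIMAL INEQUALITY (second-moment form), uniformly in `N`.** For `h ≥ 0` integrable, `f, g` continuous and in
`L²(μ_T)`, `τ ≥ 0` and `E > 0`:
`μ_T{x : E < h(x) + ∫_{(0,τ]}(|f(Φ_t x)| + |g(Φ_t x)|) dt} ≤ (2/E)∫h dμ_T + (8τ²/E²)(∫f² dμ_T + ∫g² dμ_T)`. [folklore] -/
theorem measureReal_budget_gt_le (hT : 0 < T) {h f g : PhaseSpace N → ℝ} (hh0 : ∀ x, 0 ≤ h x)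
    (hhi : Integrable h (gibbsWeight ω₂ lam β γ N T)) (hf : Continuous f) (hg : Continuous g)
    (hf2 : MemLp f 2 (gibbsWeight ω₂ lam β γ N T)) (hg2 : MemLp g 2 (gibbsWeight ω₂ lam β γ N T))
    {τ E : ℝ} (hτ : 0 ≤ τ) (hE : 0 < E) :
    (gibbsWeight ω₂ lam β γ N T).real {x | E < h x +
        ∫ t in Ioc (0 : ℝ) τ, (|f (detFlow ω₂ lam β N t x)| + |g (detFlow ω₂ lam β N t x)|)} ≤
      2 / E * ∫ x, h x ∂(gibbsWeight ω₂ lam β γ N T) +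
        8 * τ ^ 2 / E ^ 2 * ((∫ x, (f x) ^ 2 ∂(gibbsWeight ω₂ lam β γ N T)) +
          ∫ x, (g x) ^ 2 ∂(gibbsWeight ω₂ lam β γ N T)) := by
  set μ := gibbsWeight ω₂ lam β γ N T with hμ
  haveI : IsFiniteMeasure μ := isFiniteMeasure_gibbsWeight hω hl hβ γ N hT
  set I : PhaseSpace N → ℝ := fun x =>
    ∫ t in Ioc (0 : ℝ) τ, (|f (detFlow ω₂ lam β N t x)| + |g (detFlow ω₂ lam β N t x)|) with hI
  have hI0 : ∀ x, 0 ≤ I x := fun x =>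
    setIntegral_nonneg measurableSet_Ioc fun t _ => add_nonneg (abs_nonneg _) (abs_nonneg _)
  have hIsm : StronglyMeasurable I := budget_stronglyMeasurable hω hl hβ N hf hg τ
  -- the two transported square windows and their integrals (Tonelli + Liouville)
  obtain ⟨hWf, hWf_eq⟩ := integral_setIntegral_sq_comp_detFlow hω hl hβ γ N hT hτ hf hf2
  obtain ⟨hWg, hWg_eq⟩ := integral_setIntegral_sq_comp_detFlow hω hl hβ γ N hT hτ hg hg2
  -- `I² ≤ 2τ (W_f + W_g)` pointwise, hence `I²` integrable with the corresponding integral bound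
  have hI2_le : ∀ x, (I x) ^ 2 ≤ 2 * τ * ((∫ t in Ioc (0 : ℝ) τ, (f (detFlow ω₂ lam β N t x)) ^ 2) +
      ∫ t in Ioc (0 : ℝ) τ, (g (detFlow ω₂ lam β N t x)) ^ 2) := fun x =>
    sq_budgetIntegral_le hω hl hβ N hf hg hτ x
  have hI2i : Integrable (fun x => (I x) ^ 2) μ := by
    refine Integrable.mono' ((hWf.add hWg).const_mul (2 * τ)) ((hIsm.measurable.pow_const 2).aestronglyMeasurable)
      (Eventually.of_forall fun x => ?_)
    rw [Real.norm_of_nonneg (sq_nonneg _)]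
    exact hI2_le x
  have hI2_int : ∫ x, (I x) ^ 2 ∂μ ≤ 2 * τ ^ 2 * ((∫ x, (f x) ^ 2 ∂μ) + ∫ x, (g x) ^ 2 ∂μ) := by
    calc ∫ x, (I x) ^ 2 ∂μ ≤ ∫ x, 2 * τ * ((∫ t in Ioc (0 : ℝ) τ, (f (detFlow ω₂ lam β N t x)) ^ 2) +
          ∫ t in Ioc (0 : ℝ) τ, (g (detFlow ω₂ lam β N t x)) ^ 2) ∂μ :=
          integral_mono hI2i ((hWf.add hWg).const_mul (2 * τ)) hI2_le
      _ = 2 * τ ^ 2 * ((∫ x, (f x) ^ 2 ∂μ) + ∫ x, (g x) ^ 2 ∂μ) := by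
          rw [integral_const_mul, integral_add hWf hWg, hWf_eq, hWg_eq]; ring
  -- inclusion `{E < h + I} ⊆ {E/2 ≤ h} ∪ {E/2 ≤ I}` and `{E/2 ≤ I} ⊆ {E²/4 ≤ I²}`
  have hsub : {x | E < h x + I x} ⊆ {x | E / 2 ≤ h x} ∪ {x | E ^ 2 / 4 ≤ (I x) ^ 2} := by
    intro x hx
    simp only [mem_setOf_eq, mem_union] at hx ⊢
    by_contra hc
    simp only [not_or, not_le] at hc
    have h2 : I x < E / 2 := by
      by_contra h2
      have h2' : E / 2 ≤ I x := le_of_not_gt h2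
      have : E ^ 2 / 4 ≤ (I x) ^ 2 := by nlinarith [hI0 x, hE]
      linarith [hc.2]
    linarith [hc.1]
  -- Markov and Chebyshev
  have hM1 : E / 2 * μ.real {x | E / 2 ≤ h x} ≤ ∫ x, h x ∂μ :=
    mul_meas_ge_le_integral_of_nonneg (Eventually.of_forall hh0) hhi (E / 2)
  have hM2 : E ^ 2 / 4 * μ.real {x | E ^ 2 / 4 ≤ (I x) ^ 2} ≤ ∫ x, (I x) ^ 2 ∂μ :=
    mul_meas_ge_le_integral_of_nonneg (Eventually.of_forall fun x => sq_nonneg (I x)) hI2i (E ^ 2 / 4)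
  have hE2 : 0 < E / 2 := by positivity
  have hE4 : 0 < E ^ 2 / 4 := by positivity
  have hA : μ.real {x | E / 2 ≤ h x} ≤ 2 / E * ∫ x, h x ∂μ := by
    rw [div_mul_eq_mul_div, le_div_iff₀ hE]
    nlinarith
  have hB : μ.real {x | E ^ 2 / 4 ≤ (I x) ^ 2} ≤ 8 * τ ^ 2 / E ^ 2 * ((∫ x, (f x) ^ 2 ∂μ) + ∫ x, (g x) ^ 2 ∂μ) := by
    have hE20 : 0 < E ^ 2 := by positivity
    rw [div_mul_eq_mul_div, le_div_iff₀ hE20]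
    nlinarith [hI2_int]
  calc μ.real {x | E < h x + I x} ≤ μ.real ({x | E / 2 ≤ h x} ∪ {x | E ^ 2 / 4 ≤ (I x) ^ 2}) :=
        measureReal_mono hsub (measure_ne_top μ _)
    _ ≤ μ.real {x | E / 2 ≤ h x} + μ.real {x | E ^ 2 / 4 ≤ (I x) ^ 2} := measureReal_union_le _ _
    _ ≤ _ := add_le_add hA hB

end Budget

/-! ### Registered sub-goal of the line (closed form of `measureReal_budget_gt_le`) -/

/-- **Sub-goal `stub_blockMaximal`** (registered on the crux item for this helper file; closed `∀`-form of
`measureReal_budget_gt_le`): the `N`-uniform second-moment maximal inequality for the energy budget of the block cone. [folklore] -/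
theorem stub_blockMaximal : ∀ (ω₂ lam β : ℝ), 0 < ω₂ → 0 ≤ lam → 0 ≤ β → ∀ (γ : ℝ) (N : ℕ) (T : ℝ), 0 < T → ∀ (h f g : PhaseSpace N → ℝ), (∀ x, 0 ≤ h x) → MeasureTheory.Integrable h (gibbsWeight ω₂ lam β γ N T) → Continuous f → Continuous g → MeasureTheory.MemLp f 2 (gibbsWeight ω₂ lam β γ N T) → MeasureTheory.MemLp g 2 (gibbsWeight ω₂ lam β γ N T) → ∀ (τ E : ℝ), 0 ≤ τ → 0 < E → (gibbsWeight ω₂ lam β γ N T).real {x | E < h x + ∫ t in Set.Ioc (0 : ℝ) τ, (|f (Summit.AtomisticToContinuum.FouriersLaw.Theorems.ClosedConeSensitivity.Negative.ZeroFrictionDictionary.detFlow ω₂ lam β N t x)| + |g (Summit.AtomisticToContinuum.FouriersLaw.Theorems.ClosedConeSensitivity.Negative.ZeroFrictionDictionary.detFlow ω₂ lam β N t x)|)} ≤ 2 / E * ∫ x, h x ∂(gibbsWeight ω₂ lam β γ N T) + 8 * τ ^ 2 / E ^ 2 * ((∫ x, (f x) ^ 2 ∂(gibbsWeight ω₂ lam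 β γ N T)) + ∫ x, (g x) ^ 2 ∂(gibbsWeight ω₂ lam β γ N T)) :=
  fun _ _ _ hω hl hβ γ N _ hT _ _ _ hh0 hhi hf hg hf2 hg2 _ _ hτ hE =>
    measureReal_budget_gt_le hω hl hβ γ N hT hh0 hhi hf hg hf2 hg2 hτ hE

end Summit.AtomisticToContinuum.FouriersLaw.Theorems.OddSectorIrreversibility.TapLeak

end
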